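import Mathlib.AlgebraicGeometry.Noetherian
import Mathlib.AlgebraicGeometry.Morphisms.FiniteType
import Literature.AlgebraicGeometry.Resolution.StalkSpecializesLocalization
import Literature.AlgebraicGeometry.Resolution.PointBlowupHsFunMono
import Summits.ResolutionOfSingularities.ResolutionOfSingularities.Theorems.FrobeniusLadderFInjectiveMacaulayficationReductions
import Summits.ResolutionOfSingularities.ResolutionOfSingularities.Theorems.FrobeniusLadderFInjectiveMacaulayficationClauseLocalizes
import HarnessLib

/-!
# The crux's stalk clause at the closed points of a finite-type scheme gives it at all points

Support file for crux stmt-ResolutionOfSingularities-15315 (`FrobeniusLadder.FInjectiveMacaulayfication`,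
line `Sketch`, lead seat c3, cycle 4): the scheme-level form of E5 (`…ClauseLocalizes.lean`,
`fiClause_localization`: the clause localizes). For a scheme `X` locally of finite type over a field `k` of
characteristic `p`, if the crux's per-stalk clause (stalk a domain; every system of parameters weakly regular
with Frobenius closed ideal) holds at every CLOSED point then it holds at EVERY point
(`fiClause_of_closedPoints`): `X` is Jacobson, so every `x` specialises to a closed `y`
(`exists_isClosed_and_specializes_of_jacobsonSpace`); `𝒪_{X,x}` is the localization of `𝒪_{X,y}` at a prime
(`isLocalizationAtPrime_stalkSpecializes`, Stacks 01J7); the clause localizes (E5) and transports along ring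
isomorphisms (`fiClause_of_ringEquiv`). This closes the gap between the certification engines (which act at
closed points: Fedder's criterion E2, deformation E1, degree-zero descent E4) and the crux's `∀ x : X'`.
-/

-- single-problem summit: the doubled namespace component is forced
set_option linter.dupNamespace false

namespace Summit.ResolutionOfSingularities.ResolutionOfSingularities.Theorems.FInjectiveMacaulayfication.ClauseLocalizes

open CategoryTheory AlgebraicGeometry IsLocalRing RingTheory.Sequence Literature.AlgebraicGeometry.Resolution

/-- **From a closed specialization to the point**: in a locally Noetherian scheme whose stalks have
characteristic `p`, if the crux's stalk clause (domain; every system of parameters weakly regular with Frobenius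
closed ideal) holds at `y` and `x ⤳ y`, it holds at `x` — the stalk at `x` is the localization of the stalk at
`y` at a prime (`isLocalizationAtPrime_stalkSpecializes`, Stacks 01J7) and the clause localizes
(`fiClause_localization`) and transports along ring isomorphisms (`fiClause_of_ringEquiv`). [folklore] -/
theorem fiClause_of_specializes (p : ℕ) [Fact p.Prime] {X : Scheme.{0}} [IsLocallyNoetherian X] {x y : X}
    (hxy : x ⤳ y) [CharP (X.presheaf.stalk y) p]
    (hy : IsDomain (X.presheaf.stalk y) ∧ ∀ d : ℕ, ringKrullDim (X.presheaf.stalk y) = d →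
      ∀ s : Fin d → X.presheaf.stalk y, (Ideal.span (Set.range s)).radical.IsMaximal →
        IsWeaklyRegular (X.presheaf.stalk y) (List.ofFn s) ∧
        ∀ z : X.presheaf.stalk y, (∃ e : ℕ, z ^ p ^ e ∈ Ideal.span
          ((fun w : X.presheaf.stalk y => w ^ p ^ e) ''
            (Ideal.span (Set.range s) : Set (X.presheaf.stalk y)))) → z ∈ Ideal.span (Set.range s)) :
    IsDomain (X.presheaf.stalk x) ∧ ∀ d : ℕ, ringKrullDim (X.presheaf.stalk x) = d →
      ∀ s : Fin d → X.presheaf.stalk x, (Ideal.span (Set.range s)).radical.IsMaximal →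
        IsWeaklyRegular (X.presheaf.stalk x) (List.ofFn s) ∧
        ∀ z : X.presheaf.stalk x, (∃ e : ℕ, z ^ p ^ e ∈ Ideal.span
          ((fun w : X.presheaf.stalk x => w ^ p ^ e) ''
            (Ideal.span (Set.range s) : Set (X.presheaf.stalk x)))) → z ∈ Ideal.span (Set.range s) := by
  letI := (X.presheaf.stalkSpecializes hxy).hom.toAlgebra
  set P := (maximalIdeal (X.presheaf.stalk x)).comap (X.presheaf.stalkSpecializes hxy).hom with hP
  haveI hloc : IsLocalization.AtPrime (X.presheaf.stalk x) P := isLocalizationAtPrime_stalkSpecializes hxy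
  have hPloc := fiClause_localization p hy P
  -- `𝒪_{X,x} ≅ (𝒪_{X,y})_P` as rings
  let e : Localization.AtPrime P ≃+* X.presheaf.stalk x :=
    (IsLocalization.algEquiv P.primeCompl (Localization.AtPrime P) (X.presheaf.stalk x)).toRingEquiv
  exact fiClause_of_ringEquiv p e hPloc

/-- **The stalk clause at the CLOSED points of a scheme locally of finite type over a field gives it at
ALL points**: such a scheme is Jacobson (every point specialises to a closed point,
`exists_isClosed_and_specializes_of_jacobsonSpace`) and locally Noetherian, and its stalks have the
characteristic `p` of the ground field (`Negative.charP_stalk`). This is the glue between a certification of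
the crux's clause at closed points (Fedder's criterion, deformation, degree-zero descent) and the crux's
quantifier `∀ x : X'`. [folklore] -/
theorem fiClause_of_closedPoints {p : ℕ} (hp : p.Prime) {k : Type} [Field k] [CharP k p] {X : Scheme.{0}}
    (f : X ⟶ Spec (.of k)) [LocallyOfFiniteType f]
    (h : ∀ y : X, IsClosed ({y} : Set X) →
      IsDomain (X.presheaf.stalk y) ∧ ∀ d : ℕ, ringKrullDim (X.presheaf.stalk y) = d →
      ∀ s : Fin d → X.presheaf.stalk y, (Ideal.span (Set.range s)).radical.IsMaximal →
        IsWeaklyRegular (X.presheaf.stalk y) (List.ofFn s) ∧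
        ∀ z : X.presheaf.stalk y, (∃ e : ℕ, z ^ p ^ e ∈ Ideal.span
          ((fun w : X.presheaf.stalk y => w ^ p ^ e) ''
            (Ideal.span (Set.range s) : Set (X.presheaf.stalk y)))) → z ∈ Ideal.span (Set.range s)) :
    ∀ x : X, IsDomain (X.presheaf.stalk x) ∧ ∀ d : ℕ, ringKrullDim (X.presheaf.stalk x) = d →
      ∀ s : Fin d → X.presheaf.stalk x, (Ideal.span (Set.range s)).radical.IsMaximal →
        IsWeaklyRegular (X.presheaf.stalk x) (List.ofFn s) ∧
        ∀ z : X.presheaf.stalk x, (∃ e : ℕ, z ^ p ^ e ∈ Ideal.span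
          ((fun w : X.presheaf.stalk x => w ^ p ^ e) ''
            (Ideal.span (Set.range s) : Set (X.presheaf.stalk x)))) → z ∈ Ideal.span (Set.range s) := by
  haveI : Fact p.Prime := ⟨hp⟩
  haveI : JacobsonSpace X := LocallyOfFiniteType.jacobsonSpace f
  haveI : IsLocallyNoetherian X := LocallyOfFiniteType.isLocallyNoetherian f
  intro x
  obtain ⟨y, hyc, hxy⟩ := exists_isClosed_and_specializes_of_jacobsonSpace x
  haveI : CharP (X.presheaf.stalk y) p := Negative.charP_stalk hp.ne_zero f y
  exact fiClause_of_specializes p hxy (h y hyc)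

/-! ## Registered form -/

/-- **E5 at the scheme level, registered helper-stub form** (fully explicit binders; = `fiClause_of_closedPoints`):
for a scheme locally of finite type over a field of characteristic `p`, the crux's stalk clause at the closed
points implies it at all points. [folklore] -/
theorem stub_clauseOfClosedPoints : ∀ (p : ℕ), p.Prime → ∀ (k : Type) [Field k] [CharP k p] (X : AlgebraicGeometry.Scheme.{0})
    (f : X ⟶ AlgebraicGeometry.Spec (.of k)), AlgebraicGeometry.LocallyOfFiniteType f →
    (∀ y : X, IsClosed ({y} : Set X) →
      IsDomain (X.presheaf.stalk y) ∧ ∀ d : ℕ, ringKrullDim (X.presheaf.stalk y) = d →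
      ∀ s : Fin d → X.presheaf.stalk y, (Ideal.span (Set.range s)).radical.IsMaximal →
        RingTheory.Sequence.IsWeaklyRegular (X.presheaf.stalk y) (List.ofFn s) ∧
        ∀ z : X.presheaf.stalk y, (∃ e : ℕ, z ^ p ^ e ∈ Ideal.span
          ((fun w : X.presheaf.stalk y => w ^ p ^ e) ''
            (Ideal.span (Set.range s) : Set (X.presheaf.stalk y)))) → z ∈ Ideal.span (Set.range s)) →
    ∀ x : X, IsDomain (X.presheaf.stalk x) ∧ ∀ d : ℕ, ringKrullDim (X.presheaf.stalk x) = d →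
      ∀ s : Fin d → X.presheaf.stalk x, (Ideal.span (Set.range s)).radical.IsMaximal →
        RingTheory.Sequence.IsWeaklyRegular (X.presheaf.stalk x) (List.ofFn s) ∧
        ∀ z : X.presheaf.stalk x, (∃ e : ℕ, z ^ p ^ e ∈ Ideal.span
          ((fun w : X.presheaf.stalk x => w ^ p ^ e) ''
            (Ideal.span (Set.range s) : Set (X.presheaf.stalk x)))) → z ∈ Ideal.span (Set.range s) :=
  fun _ hp _ _ _ _ f hf h => by
    haveI := hf
    exact fiClause_of_closedPoints hp f h

end Summit.ResolutionOfSingularities.ResolutionOfSingularities.Theorems.FInjectiveMacaulayfication.ClauseLocalizes
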